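import Mathlib
import HarnessLib
import Summits.Ventures.LatticeQCDFlow.Scoring.SingleRunMedianOfBlocks
import Summits.Ventures.LatticeQCDFlow.Scoring.WarmStartTransfer

/-!
# The single-run median-of-blocks certificate with an ABSTRACT window bound, and its WARM-START
# form: started in `π`, the radius is purely variance-driven — `4 (2/ε − 1) Var_π f ≤ N s²`

HONEST FRAMING: exact (Metropolis-corrected) sampling algorithms for lattice gauge theory;
figures of merit are autocorrelation/cost numbers at stated couplings and volumes; no
continuum-physics claim.

Venture `LatticeQCDFlow` (cell pub-lqcd), topic `Scoring`; FANOUT row 8 (`s0-cpn-nemc`, GEN-15).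
NEW WORK of the cell, not a published result; no definition is introduced.
`Scoring/SingleRunMedianOfBlocks.lean` proved the single-run certificate from a COLD start with the
any-start window bound `q = MSE_N/s²`, `MSE_N = (2/e − 1) Var_π f/N + 16 C'²/(e² N²)`.  The proof
used the window bound in exactly two places: the first block (the chain from `μ₀`) and the delayed
windows of the chain from `π` (after a regeneration).  This file records the certificate with those
two bounds as HYPOTHESES (same proof), and instantiates it for a WARM start `μ₀ = π`: every window of
the stationary chain is then a stationary window, whose deviation probability is bounded by the
VARIANCE of the time average alone (`variance_timeAverage_le_of_doeblin`), without the cold-start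
term `16 C'²/(e² N²)` — the regenerative analogue of `replicaChains_mse_le_of_doeblin_stationary`.
Printed counterpart NAMED ONLY: as in the parent file; nothing is cited as a fact.

## Content (notation of `Scoring/SingleRunMedianOfBlocks.lean`)

* `chain_map_eval_of_invariant` — started in `π`, every one-time marginal of the chain is `π`
  (measure form of `chain_marginal`); `chain_stationaryWindow_bad_le_of_doeblin` — for the chain
  started in `π` and every delay `e`: `P(s ≤ |(1/N) Σ_{i<N} f(X_{e+i}) − πf|) ≤ (2/e − 1) Var_π f/(N s²)`;
* **`chain_medianOfBlocks_confidence_of_windowBound`** — `κ(x, ·) ≥ ε π`, `ε < 1` (invariance of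
  `π` is not even needed here); if the first window of the chain from `μ₀` and every delayed window of the chain from `π` are bad
  with probability `≤ q ≤ 1/4`, then
  `P_{μ₀}( #{j < R : block j bad} ≥ R/2 ) ≤ (R − 1)(1 − e)^g + e^{−R/8}`;
* **`chain_medianOfBlocks_confidence_warm`** — WARM START: `μ₀ = π`, `ε > 0`, `|f| ≤ C`,
  `4 (2/e − 1) Var_π f ≤ N s²` ⇒ the same bound: a variance-driven radius
  `s = 2 √((2/e − 1) Var_π f / N)` at exponential confidence from ONE stationary run.

NOT CLAIMED: any `ε` for a concrete sampler; optimal constants; unbounded observables.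
-/

noncomputable section

namespace Summit.Ventures.LatticeQCDFlow.Scoring

open MeasureTheory ProbabilityTheory Filter Finset Preorder Literature.Probability.MarkovChains
open scoped ENNReal

variable {Ω : Type*} [MeasurableSpace Ω]

variable {κ : Kernel Ω Ω} [IsMarkovKernel κ] {π : Measure Ω} [IsProbabilityMeasure π] {ε : ℝ≥0∞}

/-! ### Stationary windows -/

/-- **Started in `π`, every one-time marginal is `π`** (measure form of `chain_marginal`). -/
theorem chain_map_eval_of_invariant (hπ : Kernel.Invariant κ π) (e : ℕ) :
    (Kernel.trajMeasure (X := fun _ : ℕ => Ω) π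
        (fun n : ℕ => κ.comap (fun h : (i : ↥(Finset.Iic n)) → Ω => h ⟨n, Finset.mem_Iic.2 le_rfl⟩)
          (measurable_pi_apply _))).map (fun x : ℕ → Ω => x e) = π := by
  ext B hB
  rw [← measureReal_eq_measureReal_iff (measure_ne_top _ _) (measure_ne_top _ _),
    map_measureReal_apply (measurable_pi_apply e) hB,
    ← integral_indicator_one ((measurable_pi_apply e) hB), ← integral_indicator_one hB]
  exact chain_marginal hπ e (f := B.indicator 1) (measurable_one.indicator hB) (C := 1)
    (fun y => by by_cases hy : y ∈ B <;> simp [hy])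

/-- **A stationary window is bad with probability at most `(2/e − 1) Var_π f/(N s²)`**, at every
delay `e` (Chebyshev on `variance_timeAverage_le_of_doeblin`, transported by `chain_map_shift`
and `chain_map_eval_of_invariant`). -/
theorem chain_stationaryWindow_bad_le_of_doeblin (hπ : Kernel.Invariant κ π)
    (hmin : ∀ x {B : Set Ω}, MeasurableSet B → ε * π B ≤ κ x B) (hε0 : 0 < ε)
    {f : Ω → ℝ} (hf : Measurable f) {C : ℝ} (hC : ∀ x, |f x| ≤ C) {N : ℕ} (hN : N ≠ 0)
    {s : ℝ} (hs : 0 < s) (e : ℕ) :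
    ∫ y, (fun z : ℕ → Ω => if s ≤ |(∑ i ∈ Finset.range N, f (z i)) / N - ∫ w, f w ∂π|
        then (1 : ℝ) else 0) (fun n => y (e + n))
        ∂(Kernel.trajMeasure (X := fun _ : ℕ => Ω) π
          (fun n : ℕ => κ.comap (fun h : (i : ↥(Finset.Iic n)) → Ω => h ⟨n, Finset.mem_Iic.2 le_rfl⟩)
            (measurable_pi_apply _)))
      ≤ (2 / ε.toReal - 1) * (∫ z, (f z - ∫ y, f y ∂π) ^ 2 ∂π) / N / s ^ 2 := by
  set P := Kernel.trajMeasure (X := fun _ : ℕ => Ω) π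
      (fun n : ℕ => κ.comap (fun h : (i : ↥(Finset.Iic n)) → Ω => h ⟨n, Finset.mem_Iic.2 le_rfl⟩)
        (measurable_pi_apply _)) with hP
  have hθ : Measurable (fun (y : ℕ → Ω) (n : ℕ) => y (e + n)) :=
    measurable_pi_lambda _ fun n => measurable_pi_apply _
  have hA : MeasurableSet {z : ℕ → Ω | s ≤ |(∑ i ∈ Finset.range N, f (z i)) / N - ∫ w, f w ∂π|} :=
    measurableSet_le measurable_const ((measurable_windowMean0 hf N).sub_const _).abs
  have hH : Measurable fun z : ℕ → Ω => (if s ≤ |(∑ i ∈ Finset.range N, f (z i)) / N - ∫ w, f w ∂π|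
      then (1 : ℝ) else 0) := Measurable.ite hA measurable_const measurable_const
  have hind : (fun z : ℕ → Ω => (if s ≤ |(∑ i ∈ Finset.range N, f (z i)) / N - ∫ w, f w ∂π|
      then (1 : ℝ) else 0))
      = {z : ℕ → Ω | s ≤ |(∑ i ∈ Finset.range N, f (z i)) / N - ∫ w, f w ∂π|}.indicator 1 := by
    funext z; simp only [Set.indicator_apply, Set.mem_setOf_eq, Pi.one_apply]
  rw [← integral_map hθ.aemeasurable hH.aestronglyMeasurable, hP, chain_map_shift κ π e,
    chain_map_eval_of_invariant hπ e, hind, integral_indicator_one hA]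
  -- Chebyshev about `πf`, the mean of the stationary time average
  have hmem : MemLp (fun y : ℕ → Ω => (∑ i ∈ Finset.range N, f (y i)) / N) 2 P := by
    refine MemLp.of_bound (measurable_windowMean0 hf N).aestronglyMeasurable C
      (ae_of_all _ fun y => ?_)
    have hNpos : (0 : ℝ) < N := by exact_mod_cast Nat.pos_of_ne_zero hN
    rw [Real.norm_eq_abs, abs_div, Nat.abs_cast, div_le_iff₀ hNpos]
    calc |∑ i ∈ Finset.range N, f (y i)| ≤ ∑ i ∈ Finset.range N, |f (y i)| :=
          Finset.abs_sum_le_sum_abs _ _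
      _ ≤ ∑ i ∈ Finset.range N, C := Finset.sum_le_sum fun i _ => hC _
      _ = C * N := by rw [Finset.sum_const, Finset.card_range, nsmul_eq_mul, mul_comm]
  rw [← hP]
  refine (measureReal_abs_sub_ge_le hmem (∫ z, f z ∂π) hs).trans
    (div_le_div_of_nonneg_right ?_ (sq_nonneg s))
  rw [hP, chain_sqError_eq_variance hπ hf hC hN]
  have h := variance_timeAverage_le_of_doeblin hπ hmin hε0 hf hC hN
  rw [autocov_zero] at h
  exact h

/-! ### The certificate with abstract window bounds, and the warm start -/

/-- **THE SINGLE-RUN CERTIFICATE WITH ABSTRACT WINDOW BOUNDS.**  `κ(x, ·) ≥ ε π`, `ε < 1` (`π` any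
probability law minorising the kernel); block structure as in `Scoring/SingleRunMedianOfBlocks.lean`; if the first window of the
chain from `μ₀` is bad with probability `≤ q` and every delayed window of the chain from `π` is bad
with probability `≤ q`, where `0 ≤ q ≤ 1/4`, then
`P_{μ₀}( #{j < R : s ≤ |block mean_j − πf|} ≥ R/2 ) ≤ (R − 1)(1 − e)^g + e^{−R/8}`. -/
theorem chain_medianOfBlocks_confidence_of_windowBound
    (hmin : ∀ x {B : Set Ω}, MeasurableSet B → ε * π B ≤ κ x B) (hε1 : ε < 1)
    {f : Ω → ℝ} (hf : Measurable f) {N : ℕ} (hN : N ≠ 0) (g R : ℕ) {s : ℝ}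
    (μ₀ : Measure Ω) [IsProbabilityMeasure μ₀] {q : ℝ} (hq0 : 0 ≤ q) (hq4 : q ≤ 1 / 4)
    (hblk0 : ∫ y, (if s ≤ |(∑ i ∈ Finset.range N, f (y i)) / N - ∫ z, f z ∂π| then (1 : ℝ) else 0)
        ∂(Kernel.trajMeasure (X := fun _ : ℕ => Ω) μ₀
          (fun n : ℕ => κ.comap (fun h : (i : ↥(Finset.Iic n)) → Ω => h ⟨n, Finset.mem_Iic.2 le_rfl⟩)
            (measurable_pi_apply _))) ≤ q)
    (hdel : ∀ e : ℕ, 1 ≤ e → ∫ y, (fun z : ℕ → Ω =>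
        if s ≤ |(∑ i ∈ Finset.range N, f (z i)) / N - ∫ w, f w ∂π| then (1 : ℝ) else 0)
          (fun n => y (e + n))
        ∂(Kernel.trajMeasure (X := fun _ : ℕ => Ω) π
          (fun n : ℕ => κ.comap (fun h : (i : ↥(Finset.Iic n)) → Ω => h ⟨n, Finset.mem_Iic.2 le_rfl⟩)
            (measurable_pi_apply _))) ≤ q) :
    (Kernel.trajMeasure (X := fun _ : ℕ => Ω) μ₀
        (fun n : ℕ => κ.comap (fun h : (i : ↥(Finset.Iic n)) → Ω => h ⟨n, Finset.mem_Iic.2 le_rfl⟩)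
          (measurable_pi_apply _))).real
        {y | (R : ℝ) / 2 ≤ ∑ j ∈ Finset.range R,
          (if s ≤ |(∑ i ∈ Finset.range N, f (y (j * (N + g) + i))) / N - ∫ z, f z ∂π|
            then (1 : ℝ) else 0)}
      ≤ ((R - 1 : ℕ) : ℝ) * (1 - ε.toReal) ^ g + Real.exp (-((R : ℝ) / 8)) := by
  -- (0) constants
  set m := ∫ z, f z ∂π with hm
  have he0 : 0 ≤ 1 - ε.toReal := by
    have := (ENNReal.toReal_lt_toReal (ne_top_of_lt hε1) ENNReal.one_ne_top).2 hε1
    rw [ENNReal.toReal_one] at this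
    linarith
  -- (1) the split chain with regeneration law `π`, started from `μ₀ ⊗ δ_false`
  obtain ⟨κs, hMk, hκs, hfst, -⟩ := exists_splitChain (κ := κ) (ν := π) (hmin := hmin) hε1 μ₀
  haveI := hMk
  haveI : IsProbabilityMeasure (μ₀.map (fun y : Ω => (y, false))) :=
    Measure.isProbabilityMeasure_map (measurable_tagCoin false).aemeasurable
  set Ps := Kernel.trajMeasure (X := fun _ : ℕ => Ω × Bool) (μ₀.map (fun y : Ω => (y, false)))
      (fun n : ℕ => κs.comap (fun h : (i : ↥(Finset.Iic n)) → Ω × Bool =>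
        h ⟨n, Finset.mem_Iic.2 le_rfl⟩) (measurable_pi_apply _)) with hPs
  have hfstm : Measurable (fun (x : ℕ → Ω × Bool) (n : ℕ) => (x n).1) :=
    measurable_pi_lambda _ fun n => measurable_fst.comp (measurable_pi_apply _)
  -- (2) the objects on the split chain: bad blocks, all-tails gaps, good-gap bad blocks `χ`
  -- bad j x  := 1{s ≤ |mean of block j − m|};  tails j x := ∏ over gap j of 1{tails};
  -- χ j x := (if j = 0 then 1 else 1 − tails (j−1) x) * bad j x
  have hbadm : ∀ j : ℕ, Measurable fun x : ℕ → Ω × Bool =>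
      (if s ≤ |(∑ i ∈ Finset.range N, f ((x (j * (N + g) + i)).1)) / N - m| then (1 : ℝ) else 0) :=
    fun j => by
    refine Measurable.ite ?_ measurable_const measurable_const
    exact measurableSet_le measurable_const (((Finset.measurable_sum _ fun i _ =>
      hf.comp (measurable_fst.comp (measurable_pi_apply _))).div_const _).sub_const _).abs
  have hbad01 : ∀ (j : ℕ) (x : ℕ → Ω × Bool),
      (if s ≤ |(∑ i ∈ Finset.range N, f ((x (j * (N + g) + i)).1)) / N - m| then (1 : ℝ) else 0) = 0
      ∨ (if s ≤ |(∑ i ∈ Finset.range N, f ((x (j * (N + g) + i)).1)) / N - m| then (1 : ℝ) else 0)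
        = 1 := fun j x => by split_ifs <;> simp
  have htails01 : ∀ (b : ℕ) (x : ℕ → Ω × Bool),
      (∏ i ∈ Finset.range g, (if (x (b + i + 1)).2 then (0 : ℝ) else 1)) = 0
      ∨ (∏ i ∈ Finset.range g, (if (x (b + i + 1)).2 then (0 : ℝ) else 1)) = 1 := fun b x => by
    by_cases h : ∃ i ∈ Finset.range g, (x (b + i + 1)).2 = true
    · obtain ⟨i, hi, hx⟩ := h
      exact Or.inl (Finset.prod_eq_zero hi (by rw [if_pos hx]))
    · exact Or.inr (Finset.prod_eq_one fun i hi => by rw [if_neg (fun hx => h ⟨i, hi, hx⟩)])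
  -- the gap factor
  have hgapm : ∀ j : ℕ, Measurable fun x : ℕ → Ω × Bool => (if j = 0 then (1 : ℝ) else
      1 - ∏ i ∈ Finset.range g, (if (x ((j - 1) * (N + g) + (N - 1) + i + 1)).2 then (0 : ℝ) else 1)) :=
    fun j => by
    by_cases hj : j = 0
    · simp only [hj, if_true]; exact measurable_const
    · simp only [hj, if_false]; exact measurable_const.sub (measurable_tailsProd _ g)
  -- χ
  set χ : ℕ → (ℕ → Ω × Bool) → ℝ := fun j x => (if j = 0 then (1 : ℝ) else
      1 - ∏ i ∈ Finset.range g, (if (x ((j - 1) * (N + g) + (N - 1) + i + 1)).2 then (0 : ℝ) else 1))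
      * (if s ≤ |(∑ i ∈ Finset.range N, f ((x (j * (N + g) + i)).1)) / N - m| then (1 : ℝ) else 0)
    with hχ
  have hχm : ∀ j, Measurable (χ j) := fun j => (hgapm j).mul (hbadm j)
  have hχ01 : ∀ j x, χ j x = 0 ∨ χ j x = 1 := fun j x => by
    simp only [hχ]
    rcases hbad01 j x with h | h <;> rw [h]
    · left; rw [mul_zero]
    · rw [mul_one]
      by_cases hj : j = 0
      · right; rw [if_pos hj]
      · rw [if_neg hj]
        rcases htails01 ((j - 1) * (N + g) + (N - 1)) x with h' | h' <;> rw [h'] <;> norm_num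
  -- χ j depends only on times ≤ j(N+g) + (N − 1)
  have hNg : ∀ j : ℕ, j * (N + g) + (N - 1) + g + 1 = (j + 1) * (N + g) := fun j => by
    have := Nat.pos_of_ne_zero hN
    rw [Nat.succ_mul]
    omega
  have hχd : ∀ j, DependsOn (χ j) (Set.Iic (j * (N + g) + (N - 1))) := by
    intro j x y hxy
    simp only [hχ]
    have hNpos := Nat.pos_of_ne_zero hN
    congr 1
    · by_cases hj : j = 0
      · rw [if_pos hj, if_pos hj]
      · rw [if_neg hj, if_neg hj]
        congr 1
        refine Finset.prod_congr rfl fun i hi => ?_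
        have hi' := Finset.mem_range.1 hi
        obtain ⟨j', rfl⟩ := Nat.exists_eq_succ_of_ne_zero hj
        have hle : (j' + 1 - 1) * (N + g) + (N - 1) + i + 1 ≤ (j' + 1) * (N + g) + (N - 1) := by
          rw [Nat.add_sub_cancel, Nat.succ_mul]; omega
        rw [hxy _ (Set.mem_Iic.2 hle)]
    · have hwin : ∀ i ∈ Finset.range N, x (j * (N + g) + i) = y (j * (N + g) + i) := fun i hi =>
        hxy _ (Set.mem_Iic.2 (by have := Finset.mem_range.1 hi; omega))
      rw [Finset.sum_congr rfl fun i hi => by rw [hwin i hi]]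
  -- (3) the one-sided conditional bound for χ: `∫ 1{S_j = c} χ_j ≤ q · Ps{S_j = c}`
  have hcond : ∀ (j : ℕ) (c : ℕ), ∫ x, (if ∑ i ∈ Finset.range j, χ i x = (c : ℝ) then (1 : ℝ) else 0)
      * χ j x ∂Ps ≤ q * Ps.real {x | ∑ i ∈ Finset.range j, χ i x = (c : ℝ)} := by
    intro j c
    rcases Nat.eq_zero_or_pos j with rfl | hjpos
    · -- the first block: no gap, any-start bound for `μ₀` itself
      simp only [Finset.range_zero, Finset.sum_empty]
      by_cases hc : (0 : ℝ) = (c : ℝ)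
      · simp only [hc, if_true, one_mul, Set.setOf_true, probReal_univ, mul_one]
        have h1 : ∫ x, χ 0 x ∂Ps = ∫ x, (fun z : ℕ → Ω =>
            if s ≤ |(∑ i ∈ Finset.range N, f (z i)) / N - m| then (1 : ℝ) else 0)
            ((fun (x : ℕ → Ω × Bool) (n : ℕ) => (x n).1) x) ∂Ps := by
          refine integral_congr_ae (ae_of_all _ fun x => ?_)
          simp only [hχ, if_true, one_mul, Nat.zero_mul, Nat.zero_add]
        have hH : Measurable fun z : ℕ → Ω =>
            (if s ≤ |(∑ i ∈ Finset.range N, f (z i)) / N - m| then (1 : ℝ) else 0) := by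
          refine Measurable.ite ?_ measurable_const measurable_const
          exact measurableSet_le measurable_const ((measurable_windowMean0 hf N).sub_const _).abs
        rw [h1, ← integral_map hfstm.aemeasurable hH.aestronglyMeasurable, hPs, hfst]
        exact hblk0
      · simp only [hc, if_false, zero_mul, integral_zero]
        exact mul_nonneg hq0 measureReal_nonneg
    · -- later blocks: the gap lemma with `G = 1{S_j = c}` and `H` = bad window
      obtain ⟨j', rfl⟩ := Nat.exists_eq_succ_of_ne_zero hjpos.ne'
      set b := j' * (N + g) + (N - 1) with hb
      have hsb : (j' + 1) * (N + g) = b + g + 1 := (hNg j').symm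
      have hGm : Measurable fun x : ℕ → Ω × Bool =>
          (if ∑ i ∈ Finset.range (j' + 1), χ i x = (c : ℝ) then (1 : ℝ) else 0) :=
        Measurable.ite ((measurable_count hχm (j' + 1)) (measurableSet_singleton _))
          measurable_const measurable_const
      have hGd : DependsOn (fun x : ℕ → Ω × Bool =>
          (if ∑ i ∈ Finset.range (j' + 1), χ i x = (c : ℝ) then (1 : ℝ) else 0)) (Set.Iic b) := by
        intro x y hxy
        have : ∑ i ∈ Finset.range (j' + 1), χ i x = ∑ i ∈ Finset.range (j' + 1), χ i y := by
          refine Finset.sum_congr rfl fun i hi => hχd i (fun t ht => hxy t ?_)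
          have hi' : i ≤ j' := Nat.lt_succ_iff.1 (Finset.mem_range.1 hi)
          have : i * (N + g) ≤ j' * (N + g) := Nat.mul_le_mul_right _ hi'
          exact Set.mem_Iic.2 ((Set.mem_Iic.1 ht).trans (by rw [hb]; omega))
        simp only [this]
      have hH : Measurable fun z : ℕ → Ω =>
          (if s ≤ |(∑ i ∈ Finset.range N, f (z i)) / N - m| then (1 : ℝ) else 0) := by
        refine Measurable.ite ?_ measurable_const measurable_const
        exact measurableSet_le measurable_const ((measurable_windowMean0 hf N).sub_const _).abs
      have hgap := splitChain_gap_le κs (μ₀.map (fun y : Ω => (y, false))) (κ := κ) (ν := π)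
        (hmin := hmin) hε1 hκs hH (CH := 1) (fun y => by split_ifs <;> norm_num)
        (fun y => by split_ifs <;> norm_num) hq0 (g := g) (b := b) (s := (j' + 1) * (N + g)) hsb
        (fun e he1 _ => hdel e he1)
        hGm hGd (CG := 1) (fun x => by split_ifs <;> norm_num) (fun x => by split_ifs <;> norm_num)
      rw [← hPs] at hgap
      have hlhs : ∫ x, (if ∑ i ∈ Finset.range (j' + 1), χ i x = (c : ℝ) then (1 : ℝ) else 0)
          * χ (j' + 1) x ∂Ps
          = ∫ x, (if ∑ i ∈ Finset.range (j' + 1), χ i x = (c : ℝ) then (1 : ℝ) else 0)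
            * (1 - ∏ i ∈ Finset.range g, (if (x (b + i + 1)).2 then (0 : ℝ) else 1))
            * (fun z : ℕ → Ω => if s ≤ |(∑ i ∈ Finset.range N, f (z i)) / N - m|
                then (1 : ℝ) else 0) (fun n => (x ((j' + 1) * (N + g) + n)).1) ∂Ps := by
        refine integral_congr_ae (ae_of_all _ fun x => ?_)
        simp only [hχ, Nat.add_sub_cancel, Nat.succ_ne_zero, if_false, hb]
        ring
      rw [hlhs, measureReal_countEq_eq_integral Ps hχm]
      exact hgap
  -- (4) the Chernoff count bound for χ
  have hcount := measureReal_countGe_half_le_exp Ps hχm hχ01 hq0 hq4 hcond R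
  -- (5) all-tails gaps: each has probability `(1 − e)^g`
  have htails : ∀ j' : ℕ, Ps.real {x | ∏ i ∈ Finset.range g,
      (if (x (j' * (N + g) + (N - 1) + i + 1)).2 then (0 : ℝ) else 1) = 1} = (1 - ε.toReal) ^ g := by
    intro j'
    have hE : MeasurableSet {x : ℕ → Ω × Bool | ∏ i ∈ Finset.range g,
        (if (x (j' * (N + g) + (N - 1) + i + 1)).2 then (0 : ℝ) else 1) = 1} :=
      (measurable_tailsProd _ g) (measurableSet_singleton _)
    rw [← integral_indicator_one hE]
    have hind : ∀ x : ℕ → Ω × Bool, ({x : ℕ → Ω × Bool | ∏ i ∈ Finset.range g,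
        (if (x (j' * (N + g) + (N - 1) + i + 1)).2 then (0 : ℝ) else 1) = 1}.indicator
          (1 : (ℕ → Ω × Bool) → ℝ)) x
        = (fun _ => (1 : ℝ)) x * ∏ i ∈ Finset.range g,
          (if (x (j' * (N + g) + (N - 1) + i + 1)).2 then (0 : ℝ) else 1) := fun x => by
      simp only [Set.indicator_apply, Set.mem_setOf_eq, Pi.one_apply, one_mul]
      rcases htails01 (j' * (N + g) + (N - 1)) x with h | h <;> rw [h] <;> norm_num
    simp_rw [hind]
    rw [hPs, splitChain_tailsRun κs _ (κ := κ) (ν := π) (hmin := hmin) hε1 hκs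
      (j' * (N + g) + (N - 1)) measurable_const (dependsOn_const (1 : ℝ) |>.mono
        (Set.empty_subset _)) (CG := 1) (fun _ => by simp) g, integral_const, probReal_univ,
      one_smul, mul_one]
  -- (6) on the split chain: bad count ≤ χ count unless some gap is all tails
  have hsub : {x : ℕ → Ω × Bool | (R : ℝ) / 2 ≤ ∑ j ∈ Finset.range R,
        (if s ≤ |(∑ i ∈ Finset.range N, f ((x (j * (N + g) + i)).1)) / N - m| then (1 : ℝ) else 0)}
      ⊆ {x | (R : ℝ) / 2 ≤ ∑ j ∈ Finset.range R, χ j x}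
        ∪ ⋃ j' ∈ Finset.range (R - 1), {x | ∏ i ∈ Finset.range g,
          (if (x (j' * (N + g) + (N - 1) + i + 1)).2 then (0 : ℝ) else 1) = 1} := by
    intro x hx
    by_cases hall : ∃ j' ∈ Finset.range (R - 1), ∏ i ∈ Finset.range g,
        (if (x (j' * (N + g) + (N - 1) + i + 1)).2 then (0 : ℝ) else 1) = 1
    · right
      simp only [Set.mem_iUnion, Set.mem_setOf_eq, exists_prop]
      exact hall
    · left
      simp only [Set.mem_setOf_eq] at hx ⊢
      refine hx.trans (le_of_eq (Finset.sum_congr rfl fun j hj => ?_))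
      simp only [hχ]
      by_cases hj0 : j = 0
      · rw [if_pos hj0, one_mul]
      · rw [if_neg hj0]
        have hj' : j - 1 ∈ Finset.range (R - 1) := by
          have := Finset.mem_range.1 hj
          exact Finset.mem_range.2 (by omega)
        rcases htails01 ((j - 1) * (N + g) + (N - 1)) x with h | h
        · rw [h, sub_zero, one_mul]
        · exact absurd ⟨j - 1, hj', h⟩ hall
  -- (7) transfer to the simulated chain and assemble
  have hE : MeasurableSet {y : ℕ → Ω | (R : ℝ) / 2 ≤ ∑ j ∈ Finset.range R,
      (if s ≤ |(∑ i ∈ Finset.range N, f (y (j * (N + g) + i))) / N - ∫ z, f z ∂π|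
        then (1 : ℝ) else 0)} := by
    refine measurableSet_le measurable_const (Finset.measurable_sum _ fun j _ => ?_)
    refine Measurable.ite ?_ measurable_const measurable_const
    exact measurableSet_le measurable_const (((measurable_windowMean hf _ N)).sub_const _).abs
  rw [← hfst, map_measureReal_apply hfstm hE]
  have hpre : (fun (x : ℕ → Ω × Bool) (n : ℕ) => (x n).1) ⁻¹' {y : ℕ → Ω | (R : ℝ) / 2 ≤
      ∑ j ∈ Finset.range R, (if s ≤ |(∑ i ∈ Finset.range N, f (y (j * (N + g) + i))) / N
        - ∫ z, f z ∂π| then (1 : ℝ) else 0)}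
      = {x : ℕ → Ω × Bool | (R : ℝ) / 2 ≤ ∑ j ∈ Finset.range R,
        (if s ≤ |(∑ i ∈ Finset.range N, f ((x (j * (N + g) + i)).1)) / N - m| then (1 : ℝ)
          else 0)} := rfl
  rw [hpre]
  calc Ps.real _ ≤ Ps.real ({x | (R : ℝ) / 2 ≤ ∑ j ∈ Finset.range R, χ j x}
        ∪ ⋃ j' ∈ Finset.range (R - 1), {x | ∏ i ∈ Finset.range g,
          (if (x (j' * (N + g) + (N - 1) + i + 1)).2 then (0 : ℝ) else 1) = 1}) :=
        measureReal_mono hsub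
    _ ≤ Ps.real {x | (R : ℝ) / 2 ≤ ∑ j ∈ Finset.range R, χ j x}
        + Ps.real (⋃ j' ∈ Finset.range (R - 1), {x | ∏ i ∈ Finset.range g,
          (if (x (j' * (N + g) + (N - 1) + i + 1)).2 then (0 : ℝ) else 1) = 1}) :=
        measureReal_union_le _ _
    _ ≤ Real.exp (-((R : ℝ) / 8)) + ∑ j' ∈ Finset.range (R - 1), Ps.real {x | ∏ i ∈ Finset.range g,
          (if (x (j' * (N + g) + (N - 1) + i + 1)).2 then (0 : ℝ) else 1) = 1} :=
        add_le_add hcount (measureReal_biUnion_finset_le _ _)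
    _ = ((R - 1 : ℕ) : ℝ) * (1 - ε.toReal) ^ g + Real.exp (-((R : ℝ) / 8)) := by
        simp_rw [htails]
        rw [Finset.sum_const, Finset.card_range, nsmul_eq_mul, add_comm]


/-- **WARM START: a purely variance-driven radius at exponential confidence from ONE run.**  `π`
invariant, `κ(x, ·) ≥ ε π`, `0 < ε < 1`, `|f| ≤ C`, `N ≥ 1`, `4 (2/e − 1) Var_π f ≤ N s²`: for the
chain STARTED IN `π`,
`P_π( #{j < R : s ≤ |(1/N) Σ_{i<N} f(X_{j(N+g)+i}) − πf|} ≥ R/2 ) ≤ (R − 1)(1 − e)^g + e^{−R/8}`. -/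
theorem chain_medianOfBlocks_confidence_warm (hπ : Kernel.Invariant κ π)
    (hmin : ∀ x {B : Set Ω}, MeasurableSet B → ε * π B ≤ κ x B) (hε0 : 0 < ε) (hε1 : ε < 1)
    {f : Ω → ℝ} (hf : Measurable f) {C : ℝ} (hC : ∀ x, |f x| ≤ C) {N : ℕ} (hN : N ≠ 0) (g R : ℕ)
    {s : ℝ} (hs : 0 < s)
    (hsmall : 4 * ((2 / ε.toReal - 1) * (∫ z, (f z - ∫ y, f y ∂π) ^ 2 ∂π) / N) ≤ s ^ 2) :
    (Kernel.trajMeasure (X := fun _ : ℕ => Ω) π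
        (fun n : ℕ => κ.comap (fun h : (i : ↥(Finset.Iic n)) → Ω => h ⟨n, Finset.mem_Iic.2 le_rfl⟩)
          (measurable_pi_apply _))).real
        {y | (R : ℝ) / 2 ≤ ∑ j ∈ Finset.range R,
          (if s ≤ |(∑ i ∈ Finset.range N, f (y (j * (N + g) + i))) / N - ∫ z, f z ∂π|
            then (1 : ℝ) else 0)}
      ≤ ((R - 1 : ℕ) : ℝ) * (1 - ε.toReal) ^ g + Real.exp (-((R : ℝ) / 8)) := by
  have hV0 : 0 ≤ (2 / ε.toReal - 1) * (∫ z, (f z - ∫ y, f y ∂π) ^ 2 ∂π) / N := by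
    have h := variance_timeAverage_le_of_doeblin hπ hmin hε0 hf hC hN
    rw [autocov_zero] at h
    exact (variance_nonneg _ _).trans h
  have hq0 : 0 ≤ (2 / ε.toReal - 1) * (∫ z, (f z - ∫ y, f y ∂π) ^ 2 ∂π) / N / s ^ 2 :=
    div_nonneg hV0 (sq_nonneg s)
  have hq4 : (2 / ε.toReal - 1) * (∫ z, (f z - ∫ y, f y ∂π) ^ 2 ∂π) / N / s ^ 2 ≤ 1 / 4 := by
    rw [div_le_iff₀ (pow_pos hs 2)]; linarith
  refine chain_medianOfBlocks_confidence_of_windowBound hmin hε1 hf hN g R π hq0 hq4 ?_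
    (fun e _ => chain_stationaryWindow_bad_le_of_doeblin hπ hmin hε0 hf hC hN hs e)
  have h := chain_stationaryWindow_bad_le_of_doeblin hπ hmin hε0 hf hC hN hs 0
  simp only [Nat.zero_add] at h
  exact h

end Summit.Ventures.LatticeQCDFlow.Scoring

end
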